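import Mathlib.Analysis.Normed.Lp.lpSpace
import HarnessLib

/-!
# Reindexing the little `ℓᵖ` spaces along an equivalence of index types

Analysis/FunctionSpaces support file (two bundled isometries as `def`s + their `rfl` lemmas; no named
facts).

For a normed group `E`, an exponent `1 ≤ p < ∞` and an equivalence of index types `e : ι ≃ κ`,
precomposition with `e` is a LINEAR ISOMETRIC EQUIVALENCE `ℓᵖ(κ, E) ≃ₗᵢ ℓᵖ(ι, E)`
(`lpReindex`), with `lpReindex e f i = f (e i)`.  In particular `ℓ²(w, ℝ) ≃ₗᵢ ℓ²(ℕ, ℝ)` for every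
countably infinite index set `w` — the step that turns Mathlib's Hilbert bases
(`exists_hilbertBasis : ∃ (w : Set E) (b : HilbertBasis w 𝕜 E), …`, indexed by a SUBSET of the space,
with `HilbertBasis.repr : E ≃ₗᵢ ℓ²(w, 𝕜)`) into coordinates in the fixed model `ℓ²(ℕ, ℝ)` used by
abstract dynamical statements (e.g. the section model `Sec = lp (fun _ : ℕ => ℝ) 2` of polysection
maps of parabolic semiflows).

* `Memℓp.comp_equiv` — `Memℓp f p → Memℓp (f ∘ e) p` (`0 < p.toReal`);
* `lpReindex` — the bundled `ℓᵖ(κ, E) ≃ₗᵢ[𝕜] ℓᵖ(ι, E)` (`1 ≤ p < ∞`), with `lpReindex_apply`,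
  `lpReindex_symm_apply`;
* `lpTwoEquivNat` — `ℓ²(ι, E) ≃ₗᵢ[𝕜] ℓ²(ℕ, E)` from `e : ℕ ≃ ι`.

## Mathlib / tree search

Mathlib (this pin): `Memℓp`, `lp`, `lp.norm_eq_tsum_rpow`, `Equiv.summable_iff`, `Equiv.tsum_eq`,
`LinearIsometryEquiv`; reindexing exists for `PiLp` (`LinearIsometryEquiv.piLpCongrLeft`, finite
products) but NOT for `lp` (`grep -rn 'congr\|reindex\|Equiv' Mathlib/Analysis/Normed/Lp/lpSpace.lean`:
nothing).  Tree (`lean search 'lp .*≃ₗᵢ|reindex.*lp'`): nothing.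

## References

Folklore.
-/

noncomputable section

open scoped ENNReal

namespace Literature.Analysis.FunctionSpaces

variable {ι κ : Type*} {E : Type*} [NormedAddCommGroup E] {p : ℝ≥0∞}

/-- `ℓᵖ`-membership is invariant under reindexing along an equivalence (`0 < p < ∞` as a real
exponent). [folklore] -/
theorem Memℓp.comp_equiv (hp : 0 < p.toReal) {f : κ → E} (hf : Memℓp f p) (e : ι ≃ κ) :
    Memℓp (fun i => f (e i)) p :=
  memℓp_gen ((e.summable_iff (f := fun k => ‖f k‖ ^ p.toReal)).2 (hf.summable hp))

variable (𝕜 : Type*) [NormedField 𝕜] [NormedSpace 𝕜 E]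
variable [Fact (1 ≤ p)]

/-- The real exponent of `1 ≤ p < ∞` is positive. [folklore] -/
theorem toReal_pos_of_one_le (hp : p ≠ ∞) : 0 < p.toReal :=
  ENNReal.toReal_pos (ne_of_gt (lt_of_lt_of_le zero_lt_one (Fact.out : 1 ≤ p))) hp

/-- **Reindexing `ℓᵖ` along an equivalence of index types** (`1 ≤ p < ∞`): precomposition with
`e : ι ≃ κ` is a linear isometric equivalence `ℓᵖ(κ, E) ≃ₗᵢ[𝕜] ℓᵖ(ι, E)`. [folklore] -/
def lpReindex (hp : p ≠ ∞) (e : ι ≃ κ) : lp (fun _ : κ => E) p ≃ₗᵢ[𝕜] lp (fun _ : ι => E) p :=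
  have hp' : 0 < p.toReal := toReal_pos_of_one_le hp
  { toFun := fun f => ⟨fun i => f (e i), Memℓp.comp_equiv hp' (lp.memℓp f) e⟩
    invFun := fun g => ⟨fun k => g (e.symm k), Memℓp.comp_equiv hp' (lp.memℓp g) e.symm⟩
    map_add' := fun f g => by ext i; rfl
    map_smul' := fun c f => by ext i; rfl
    left_inv := fun f => by ext k; simp
    right_inv := fun g => by ext i; simp
    norm_map' := fun f => by
      change ‖(⟨fun i => f (e i), _⟩ : lp (fun _ : ι => E) p)‖ = ‖f‖
      rw [lp.norm_eq_tsum_rpow hp', lp.norm_eq_tsum_rpow hp']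
      congr 1
      exact e.tsum_eq (fun k => ‖f k‖ ^ p.toReal) }

/-- The reindexing isometry acts by precomposition. [folklore] -/
@[simp] theorem lpReindex_apply (hp : p ≠ ∞) (e : ι ≃ κ) (f : lp (fun _ : κ => E) p) (i : ι) :
    lpReindex 𝕜 hp e f i = f (e i) := rfl

/-- The inverse reindexing isometry acts by precomposition with the inverse equivalence. [folklore] -/
@[simp] theorem lpReindex_symm_apply (hp : p ≠ ∞) (e : ι ≃ κ) (g : lp (fun _ : ι => E) p) (k : κ) :
    (lpReindex 𝕜 hp e).symm g k = g (e.symm k) := rfl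

/-- **`ℓ²` over any index type equivalent to `ℕ` is isometric to `ℓ²(ℕ)`** — e.g. over a countably
infinite Hilbert-basis index set `w` (`Set.Countable` + `Set.Infinite` give `w ≃ ℕ` through
`Denumerable`). [folklore] -/
def lpTwoEquivNat (e : ℕ ≃ ι) : lp (fun _ : ι => E) 2 ≃ₗᵢ[𝕜] lp (fun _ : ℕ => E) 2 :=
  lpReindex 𝕜 (p := 2) ENNReal.ofNat_ne_top e

end Literature.Analysis.FunctionSpaces

end
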